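import Literature.NumberTheory.EllipticCurves.RankinSeriesTwistEulerFactorProofs
import HarnessLib

/-!
# The modular degree of a quadratic twist at a prime of GOOD or MULTIPLICATIVE reduction:
# `deg φ_{E'} · c_E² · u² = V_p · deg φ_E · c_{E'}²`, `V_p = (p − 1)((p + 1)² − a_p²)` resp. `p² − 1`
# (Watkins 2002, §2.1) — proved

A proofs-only file (theorems only: no definition, no named fact; D-0026), the companion of
`ModularDegreeQuadraticTwistProofs` (the ADDITIVE case `V_p = p`, harvest E63/E64), formalising the
remaining cases of M. Watkins, *Computing the modular degree of an elliptic curve*, Experiment. Math.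
**11** (2002), §2.1 "Quadratic Twists and Minimality", p. 491: "We write
`deg φ_E = deg φ_F · (c_E²/c_F²) · ∏_p V_p` … `V_p = (Ω_{E_p}/Ω_E)·(N_E/N_{E_p})·L^A_p(Sym² E_p, 2)^{-1}`"
(`F = E_p` the `p`-minimal twist, `E = F ⊗ χ_{p̃}`), at a prime `p` where `F` is semistable and `E` is
additive.  Printed ingredients, all theorems of the tree: Zagier's formula
`deg · covol(Λ) = 4π² c² (f, f)` for both data (`ModularParametrizationData.deg_mul_covolume_eq_re`);
Rankin's residue `Res_{w=2} Σ‖aₙ‖²n⁻ʷ = 48π (f,f)/ψ(level)` at BOTH levels and the Euler factor of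
Rankin's series at `p`, which the twist removes (`rankinResidue_eq_mul_of_twist`,
`tsum_sq_mul_pow_mul_eq_of_recurrence` of `RankinSeriesTwistEulerFactorProofs`); the index
`ψ(p²M) = p(p+1)ψ(M)` / `ψ(pM) = pψ(M)`; the Néron covolume `covol Λ(W') = u² covol Λ(W)/p`
(Pal 2012, Lemma 3.1; `IsNeronLatticeOf.covolume_eq_div_of_c₄_eq_of_c₆_eq`); Hasse `a_p² ≤ 4p`.

Main theorems (`ModularParametrizationData.…`), for `W / ℚ` elliptic, `p` an odd prime,
`W' = C • (W ⊗ χ_{p*})` (`p* = (−1)^{(p−1)/2} p`) with `aₙ(W') = 0` for `p ∣ n`, and parametrisation data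
`D` of `W` at level `M`, `D'` of `W'` at level `N`:

* `deg_mul_sq_mul_sq_eq_of_quadraticTwist_pStar_of_hasGoodReductionAtPrime`: `W` good at `p`, `p ∤ M`,
  `N = p²M` ⟹ `D'.deg · D.c² · u(C)² = (p − 1)·((p + 1)² − a_p(W)²) · D.deg · D'.c²`
  (at `p = 3`: `V₃ = 2(4 − a₃)(4 + a₃)`);
* `deg_mul_sq_mul_sq_eq_of_quadraticTwist_pStar_of_hasMultiplicativeReductionAtPrime`: `W`
  multiplicative at `p`, `p ∣ M`, `N = pM` ⟹ `D'.deg · D.c² · u(C)² = (p² − 1) · D.deg · D'.c²`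
  (at `p = 3`: `V₃ = 8`);
* the `|u| = 1` forms in `ℤ` (`…_of_abs_u_eq_one`).

Nothing is claimed about `c = c'` (Watkins: "if we assume the Manin constants are the same").

## References

* [Watkins2002] M. Watkins, *Computing the modular degree of an elliptic curve*, Experiment. Math. 11
  (2002), no. 4, 487–502, §2.1 (p. 491).
* [Pal2012] V. Pal, *Periods of quadratic twists of elliptic curves*, Proc. Amer. Math. Soc. 140 (2012),
  Remark 2.3, Lemma 3.1.
* [ZagierCMB1985] D. Zagier, *Modular parametrizations of elliptic curves*, Canad. Math. Bull. 28 (1985),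
  §1 (p. 374).
* [Delaunay2003] C. Delaunay, *Computing modular degrees using L-functions*, J. Théor. Nombres Bordeaux
  15 (2003), Thm 1 (the unequal-level case).
-/

noncomputable section

open scoped MatrixGroups ModularForm Real Topology
open Filter CongruenceSubgroup IsDedekindDomain NumberField Rat.HeightOneSpectrum

namespace Literature.NumberTheory.EllipticCurves.ModularForms

/-! ### Watkins' `V_p` at a semistable prime -/

section Main

variable {W W' : WeierstrassCurve ℚ} [W.IsElliptic] {p : ℕ} [Fact p.Prime] {M N : ℕ} [NeZero M] [NeZero N]

namespace ModularParametrizationData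

omit [W.IsElliptic] in
/-- **The Néron covolume of a model of the twist by `p*`**: for `W' = C • (W ⊗ χ_{p*})` and
parametrisation data `D, D'` of `W, W'`, `covol Λ(W') = u(C)² · covol Λ(W) / p` (the twist scales
`(c₄, c₆)` by `(p*², p*³)`, so `Λ(W ⊗ χ_{p*}) = Λ(W)/√p*` has covolume `covol Λ(W)/p` — Pal 2012,
Lemma 3.1 — and the change of variables scales the lattice by `u`). [cite: Pal2012, Lemma 3.1 and Remark 2.3] -/
theorem covolume_eq_of_smul_quadraticTwist_pStar (C : WeierstrassCurve.VariableChange ℚ)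
    (hW' : C • W.quadraticTwist (((-1 : ℤ) ^ (p / 2) * p : ℤ) : ℚ) = W')
    (D : ModularParametrizationData W M) (D' : ModularParametrizationData W' N) :
    ZLattice.covolume D'.L.lattice = ((C.u : ℚ) : ℝ) ^ 2 * (ZLattice.covolume D.L.lattice / p) := by
  have hp : p.Prime := Fact.out
  set d : ℤ := (-1 : ℤ) ^ (p / 2) * p with hd
  have hdabs : ‖((d : ℚ) : ℂ)‖ = p := by
    rw [hd]
    push_cast
    rw [norm_mul, norm_pow, norm_neg, norm_one, one_pow, one_mul, Complex.norm_natCast]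
  have hd0 : ((d : ℚ) : ℂ) ≠ 0 := by
    intro h
    rw [h, norm_zero] at hdabs
    exact hp.ne_zero (by exact_mod_cast hdabs.symm)
  set T := W.quadraticTwist ((d : ℤ) : ℚ) with hT
  have h4 : (T.baseChange ℂ).c₄ = ((d : ℚ) : ℂ) ^ 2 * (W.baseChange ℂ).c₄ := by
    simp only [hT, WeierstrassCurve.baseChange, WeierstrassCurve.map_c₄,
      WeierstrassCurve.quadraticTwist_c₄, map_mul, map_pow, eq_ratCast, Rat.cast_intCast]
  have h6 : (T.baseChange ℂ).c₆ = ((d : ℚ) : ℂ) ^ 3 * (W.baseChange ℂ).c₆ := by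
    simp only [hT, WeierstrassCurve.baseChange, WeierstrassCurve.map_c₆,
      WeierstrassCurve.quadraticTwist_c₆, map_mul, map_pow, eq_ratCast, Rat.cast_intCast]
  obtain ⟨LT, hLT⟩ : ∃ LT : PeriodPair, IsNeronLatticeOf (T.baseChange ℂ) LT := by
    obtain ⟨s, hs⟩ := IsAlgClosed.exists_pow_nat_eq ((d : ℚ) : ℂ) zero_lt_two
    have hs0 : s ≠ 0 := by
      rintro rfl
      exact hd0 (by rw [← hs]; simp)
    refine ⟨D.L.mulLeft s⁻¹ (inv_ne_zero hs0), ?_, ?_⟩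
    · rw [PeriodPair.g₂_mulLeft, D.isNeronLattice.1, h4, ← hs, inv_pow, inv_inv]
      ring
    · rw [PeriodPair.g₃_mulLeft, D.isNeronLattice.2, h6, ← hs, inv_pow, inv_inv]
      ring
  have hcovT : ZLattice.covolume LT.lattice = ZLattice.covolume D.L.lattice / p := by
    rw [IsNeronLatticeOf.covolume_eq_div_of_c₄_eq_of_c₆_eq hd0 h4 h6 D.isNeronLattice hLT, hdabs]
  have hD'L : IsNeronLatticeOf ((C • T).baseChange ℂ) D'.L := by rw [hW']; exact D'.isNeronLattice
  rw [IsNeronLatticeOf.lattice_eq_mulLeft_of_smul C hLT hD'L, PeriodPair.covolume_mulLeft_lattice, hcovT]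
  congr 1
  rw [show (((C.u : ℚ) : ℂ)) = ((((C.u : ℚ) : ℝ)) : ℂ) by norm_cast, Complex.norm_real,
    Real.norm_eq_abs, sq_abs]

omit [W.IsElliptic] in
/-- **From a residue relation to the degree identity.** If the Petersson norms of the newforms of
`W` (level `M`) and of `W' = C • (W ⊗ χ_{p*})` (level `N`) satisfy `(f, f) · V = p · (f', f')`, then
`D'.deg · D.c² · u² = V · D.deg · D'.c²` (Zagier's formula for both data and
`covol Λ(W') = u² covol Λ(W)/p`). [cite: Watkins2002, §2.1 (p. 491)] [cite: ZagierCMB1985, §1 (p. 374)] -/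
theorem deg_mul_sq_mul_sq_eq_of_peterssonProduct_mul_eq (C : WeierstrassCurve.VariableChange ℚ)
    (hW' : C • W.quadraticTwist (((-1 : ℤ) ^ (p / 2) * p : ℤ) : ℚ) = W')
    (D : ModularParametrizationData W M) (D' : ModularParametrizationData W' N) {V : ℝ}
    (hPV : (peterssonProduct (Gamma0 M) 2 D.f D.f).re * V =
      p * (peterssonProduct (Gamma0 N) 2 D'.f D'.f).re) :
    (D'.deg : ℝ) * (D.c : ℝ) ^ 2 * ((C.u : ℚ) : ℝ) ^ 2 = V * D.deg * (D'.c : ℝ) ^ 2 := by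
  have hp : p.Prime := Fact.out
  have hp0 : (p : ℝ) ≠ 0 := by exact_mod_cast hp.ne_zero
  have hZ := D.deg_mul_covolume_eq_re
  have hZ' := D'.deg_mul_covolume_eq_re
  have hcov' := covolume_eq_of_smul_quadraticTwist_pStar C hW' D D'
  have hcov0 : ZLattice.covolume D.L.lattice ≠ 0 := (ZLattice.covolume_pos _ _).ne'
  set cov := ZLattice.covolume D.L.lattice with hcov
  set cov' := ZLattice.covolume D'.L.lattice with hcovd
  set P := (peterssonProduct (Gamma0 M) 2 D.f D.f).re with hP
  set P' := (peterssonProduct (Gamma0 N) 2 D'.f D'.f).re with hP'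
  set u : ℝ := ((C.u : ℚ) : ℝ) with hu
  -- `(deg · cov) · V · c'² = p · (deg' · cov') · c²`
  have e1 : (D.deg : ℝ) * cov * V * (D'.c : ℝ) ^ 2 = p * ((D'.deg : ℝ) * cov') * (D.c : ℝ) ^ 2 := by
    rw [hZ, hZ']
    linear_combination (4 * π ^ 2 * (D.c : ℝ) ^ 2 * (D'.c : ℝ) ^ 2) * hPV
  have hpcov : (p : ℝ) * (cov / p) = cov := mul_div_cancel₀ cov hp0
  rw [hcov'] at e1
  have e2 : (V * D.deg * (D'.c : ℝ) ^ 2) * cov = ((D'.deg : ℝ) * (D.c : ℝ) ^ 2 * u ^ 2) * cov := by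
    linear_combination e1 + ((D'.deg : ℝ) * u ^ 2 * (D.c : ℝ) ^ 2) * hpcov
  exact (mul_right_cancel₀ hcov0 e2).symm

/-- **Watkins 2002, §2.1 at a prime of GOOD reduction** (`V_p = (p − 1)(p + 1 − a_p)(p + 1 + a_p)`
for the Manin constants in the normalisation `u`): let `W / ℚ` be elliptic with good reduction at the
odd prime `p`, `W' = C • (W ⊗ χ_{p*})` a model of its twist by `p* = (−1)^{(p−1)/2} p` with
`aₙ(W') = 0` for `p ∣ n` (additive at `p`), `D` a parametrisation datum of `W` at a level `M` with
`p ∤ M` and `D'` one of `W'` at level `N = p² M`. Then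
`D'.deg · D.c² · u(C)² = (p − 1)·((p + 1)² − a_p(W)²) · D.deg · D'.c²`.
Printed route: Zagier's formula at both levels, Rankin's residue `48π (f,f)/ψ(level)` at both
levels, `ψ(p²M) = p(p+1) ψ(M)`, the Euler factor of `Σ aₙ² n⁻ʷ` at `p` removed by the twist,
`Σₖ a_{p^k}² p^{-2k} = p²(p+1)/((p−1)((p+1)² − a_p²))`, and `covol Λ(W') = u² covol Λ(W)/p`
(Watkins: "`V_p = (Ω_{E_p}/Ω_E)·(N_E/N_{E_p})·L^A_p(Sym² E_p, 2)^{-1}`"). At `p = 3` this is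
`V₃ = 2(4 − a₃)(4 + a₃)`. [cite: Watkins2002, §2.1 (p. 491)] -/
theorem deg_mul_sq_mul_sq_eq_of_quadraticTwist_pStar_of_hasGoodReductionAtPrime (hp2 : p ≠ 2)
    (hgood : W.HasGoodReductionAtPrime p) (C : WeierstrassCurve.VariableChange ℚ)
    (hW' : C • W.quadraticTwist (((-1 : ℤ) ^ (p / 2) * p : ℤ) : ℚ) = W')
    (hW'0 : ∀ n : ℕ, p ∣ n → W'.LFunction n = 0)
    (D : ModularParametrizationData W M) (D' : ModularParametrizationData W' N)
    (hM : ¬ p ∣ M) (hN : N = p ^ 2 * M) :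
    (D'.deg : ℝ) * (D.c : ℝ) ^ 2 * ((C.u : ℚ) : ℝ) ^ 2 =
      ((p : ℝ) - 1) * (((p : ℝ) + 1) ^ 2 - (W.LFunction p : ℝ) ^ 2) * D.deg * (D'.c : ℝ) ^ 2 := by
  have hp : p.Prime := Fact.out
  have hp0 : (0 : ℝ) < p := by exact_mod_cast hp.pos
  have hp2' : (2 : ℝ) ≤ p := by exact_mod_cast hp.two_le
  set a : ℝ := (W.LFunction p : ℝ) with ha
  have ha2 : a ^ 2 ≤ 4 * p := sq_LFunction_prime_le W p
  -- the local sum in closed form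
  set Φ : ℝ → ℝ := fun w ↦ (1 + p * (p : ℝ) ^ (-w)) /
      ((1 - p * (p : ℝ) ^ (-w)) * ((1 + p * (p : ℝ) ^ (-w)) ^ 2 - a ^ 2 * (p : ℝ) ^ (-w))) with hΦ
  have hΦw : ∀ w : ℝ, 2 < w →
      ∑' k : ℕ, (W.LFunction (p ^ k) : ℝ) ^ 2 * ((p : ℝ) ^ (-w)) ^ k = Φ w := by
    intro w hw
    have hx0 : 0 ≤ (p : ℝ) ^ (-w) := Real.rpow_nonneg hp0.le _
    have hsum : Summable fun n : ℕ ↦ (W.LFunction n : ℝ) ^ 2 / (n : ℝ) ^ w :=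
      (summable_normSq_cuspCoeff_div_rpow D.f hw).congr
        fun n ↦ normSq_cuspCoeff_div_rpow_eq_sq_LFunction D.isNewformOf w n
    have hV : Summable fun k : ℕ ↦ (W.LFunction (p ^ k) : ℝ) ^ 2 * ((p : ℝ) ^ (-w)) ^ k :=
      (hsum.comp_injective (Nat.pow_right_injective hp.two_le)).congr
        fun k ↦ sq_LFunction_div_rpow_prime_pow W p w k
    have hid := tsum_sq_mul_pow_mul_eq_of_recurrence (fun k ↦ (W.LFunction (p ^ k) : ℝ)) a p
      ((p : ℝ) ^ (-w)) (by simp [W.isMultiplicative_LFunction.map_one]) (by simp [ha])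
      (fun k ↦ by
        have h := LFunction_prime_pow_add_two_of_hasGoodReductionAtPrime W p hgood k
        simp only [h, Int.cast_sub, Int.cast_mul, Int.cast_natCast, ha]) hx0 hV
    have hden : (1 - p * (p : ℝ) ^ (-w)) * ((1 + p * (p : ℝ) ^ (-w)) ^ 2 - a ^ 2 * (p : ℝ) ^ (-w)) ≠ 0 := by
      intro h0
      rw [h0, mul_zero] at hid
      linarith [mul_nonneg hp0.le hx0]
    simp only [hΦ]
    rw [eq_div_iff hden]
    exact hid
  -- `Φ` is continuous at `w = 2` (denominator `(1 − 1/p)((1 + 1/p)² − a²/p²) ≠ 0` by Hasse)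
  have hx : ContinuousAt (fun w : ℝ ↦ (p : ℝ) ^ (-w)) 2 :=
    (Real.continuousAt_const_rpow hp0.ne').comp continuous_neg.continuousAt
  have hx2 : (p : ℝ) ^ (-(2 : ℝ)) = ((p : ℝ) ^ 2)⁻¹ := by
    rw [Real.rpow_neg hp0.le, Real.rpow_two]
  have hden1 : (1 : ℝ) - p * ((p : ℝ) ^ 2)⁻¹ ≠ 0 := by
    rw [show (p : ℝ) * ((p : ℝ) ^ 2)⁻¹ = 1 / p by field_simp]
    have : (1 : ℝ) / p < 1 := (div_lt_one hp0).mpr (by linarith)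
    linarith
  have hden2 : (1 + p * ((p : ℝ) ^ 2)⁻¹) ^ 2 - a ^ 2 * ((p : ℝ) ^ 2)⁻¹ ≠ 0 := by
    rw [show (1 + p * ((p : ℝ) ^ 2)⁻¹) ^ 2 - a ^ 2 * ((p : ℝ) ^ 2)⁻¹ =
      (((p : ℝ) + 1) ^ 2 - a ^ 2) / (p : ℝ) ^ 2 by field_simp]
    exact div_ne_zero (by nlinarith) (by positivity)
  have hcont : ContinuousAt Φ 2 := by
    simp only [hΦ]
    refine ContinuousAt.div ?_ ?_ ?_
    · exact continuousAt_const.add (continuousAt_const.mul hx)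
    · exact (continuousAt_const.sub (continuousAt_const.mul hx)).mul
        (((continuousAt_const.add (continuousAt_const.mul hx)).pow 2).sub (continuousAt_const.mul hx))
    · rw [hx2]
      exact mul_ne_zero hden1 hden2
  -- the residue relation and the value `Φ(2) = p²(p+1)/((p−1)((p+1)² − a²))`
  have hR := rankinResidue_eq_mul_of_twist hp2 C hW' hW'0 D D' hcont hΦw
  have hNum : (1 + p * ((p : ℝ) ^ 2)⁻¹) * p = p + 1 := by
    field_simp
  have hDen : (1 - p * ((p : ℝ) ^ 2)⁻¹) * ((1 + p * ((p : ℝ) ^ 2)⁻¹) ^ 2 - a ^ 2 * ((p : ℝ) ^ 2)⁻¹) * (p : ℝ) ^ 3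
      = ((p : ℝ) - 1) * (((p : ℝ) + 1) ^ 2 - a ^ 2) := by
    field_simp
  have hΦ2' : Φ 2 * ((1 - p * ((p : ℝ) ^ 2)⁻¹) * ((1 + p * ((p : ℝ) ^ 2)⁻¹) ^ 2 - a ^ 2 * ((p : ℝ) ^ 2)⁻¹))
      = 1 + p * ((p : ℝ) ^ 2)⁻¹ := by
    simp only [hΦ]
    rw [hx2]
    exact div_mul_cancel₀ _ (mul_ne_zero hden1 hden2)
  have hΦ2 : Φ 2 * (((p : ℝ) - 1) * (((p : ℝ) + 1) ^ 2 - a ^ 2)) = (p : ℝ) ^ 2 * ((p : ℝ) + 1) := by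
    calc Φ 2 * (((p : ℝ) - 1) * (((p : ℝ) + 1) ^ 2 - a ^ 2))
        = Φ 2 * ((1 - p * ((p : ℝ) ^ 2)⁻¹) * ((1 + p * ((p : ℝ) ^ 2)⁻¹) ^ 2 - a ^ 2 * ((p : ℝ) ^ 2)⁻¹))
            * (p : ℝ) ^ 3 := by rw [← hDen]; ring
      _ = (1 + p * ((p : ℝ) ^ 2)⁻¹) * p * (p : ℝ) ^ 2 := by rw [hΦ2']; ring
      _ = (p : ℝ) ^ 2 * ((p : ℝ) + 1) := by rw [hNum]; ring
  have hψ : (gamma0Index N : ℝ) = p * (p + 1) * gamma0Index M := by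
    rw [hN, gamma0Index_prime_sq_mul_of_not_dvd hp hM]
    push_cast
    ring
  have hψM : (gamma0Index M : ℝ) ≠ 0 := by exact_mod_cast (gamma0Index_pos M).ne'
  have hπ : (π : ℝ) ≠ 0 := Real.pi_ne_zero
  set P := (peterssonProduct (Gamma0 M) 2 D.f D.f).re with hP
  set P' := (peterssonProduct (Gamma0 N) 2 D'.f D'.f).re with hP'
  have hR' : P * ((p : ℝ) * (p + 1)) = Φ 2 * P' := by
    rw [hψ] at hR
    field_simp at hR
    linear_combination hR
  have h3 : (P * (((p : ℝ) - 1) * (((p : ℝ) + 1) ^ 2 - a ^ 2)) - p * P') * ((p : ℝ) * (p + 1)) = 0 := by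
    linear_combination (((p : ℝ) - 1) * (((p : ℝ) + 1) ^ 2 - a ^ 2)) * hR' + P' * hΦ2
  have hpp : (p : ℝ) * (p + 1) ≠ 0 := by positivity
  have hPV : P * (((p : ℝ) - 1) * (((p : ℝ) + 1) ^ 2 - a ^ 2)) = p * P' := by
    have := (mul_eq_zero.mp h3).resolve_right hpp
    linarith
  have key := deg_mul_sq_mul_sq_eq_of_peterssonProduct_mul_eq C hW' D D' hPV
  rw [key]

/-- **Watkins 2002, §2.1 at a prime of MULTIPLICATIVE reduction** (`V_p = p² − 1`): let `W / ℚ` be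
elliptic with multiplicative reduction at the odd prime `p`, `W' = C • (W ⊗ χ_{p*})` a model of the
twist with `aₙ(W') = 0` for `p ∣ n`, `D` a parametrisation datum of `W` at a level `M` with `p ∣ M`
and `D'` one of `W'` at level `N = p M`. Then `D'.deg · D.c² · u(C)² = (p² − 1) · D.deg · D'.c²`
(`ψ(pM) = p ψ(M)`, `a_{p^k} = (±1)^k`, `Σₖ p^{-2k} = p²/(p² − 1)`). At `p = 3`: `V₃ = 8`.
[cite: Watkins2002, §2.1 (p. 491)] -/
theorem deg_mul_sq_mul_sq_eq_of_quadraticTwist_pStar_of_hasMultiplicativeReductionAtPrime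
    (hp2 : p ≠ 2) (hmult : W.HasMultiplicativeReductionAtPrime p) (C : WeierstrassCurve.VariableChange ℚ)
    (hW' : C • W.quadraticTwist (((-1 : ℤ) ^ (p / 2) * p : ℤ) : ℚ) = W')
    (hW'0 : ∀ n : ℕ, p ∣ n → W'.LFunction n = 0)
    (D : ModularParametrizationData W M) (D' : ModularParametrizationData W' N)
    (hM : p ∣ M) (hN : N = p * M) :
    (D'.deg : ℝ) * (D.c : ℝ) ^ 2 * ((C.u : ℚ) : ℝ) ^ 2 = ((p : ℝ) ^ 2 - 1) * D.deg * (D'.c : ℝ) ^ 2 := by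
  have hp : p.Prime := Fact.out
  have hp0 : (0 : ℝ) < p := by exact_mod_cast hp.pos
  have hp1 : (1 : ℝ) < p := by exact_mod_cast hp.one_lt
  -- the local sum: `a_{p^k}² = 1`
  have hsq : ∀ k, ((W.LFunction (p ^ k) : ℤ) : ℝ) ^ 2 = 1 := by
    intro k
    obtain ⟨hk, h1⟩ := LFunction_prime_pow_of_hasMultiplicativeReductionAtPrime W p hmult k
    rw [hk, Int.cast_pow, ← pow_mul, mul_comm, pow_mul]
    have h1' : ((W.LFunction p : ℤ) : ℝ) ^ 2 = 1 := by exact_mod_cast h1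
    rw [h1', one_pow]
  set Φ : ℝ → ℝ := fun w ↦ (1 - (p : ℝ) ^ (-w))⁻¹ with hΦ
  have hΦw : ∀ w : ℝ, 2 < w →
      ∑' k : ℕ, (W.LFunction (p ^ k) : ℝ) ^ 2 * ((p : ℝ) ^ (-w)) ^ k = Φ w := by
    intro w hw
    have hx0 : 0 ≤ (p : ℝ) ^ (-w) := Real.rpow_nonneg hp0.le _
    have hx1 : (p : ℝ) ^ (-w) < 1 := Real.rpow_lt_one_of_one_lt_of_neg hp1 (by linarith)
    exact tsum_sq_mul_pow_eq_of_sq_eq_one _ hsq hx0 hx1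
  have hx : ContinuousAt (fun w : ℝ ↦ (p : ℝ) ^ (-w)) 2 :=
    (Real.continuousAt_const_rpow hp0.ne').comp continuous_neg.continuousAt
  have hx2 : (p : ℝ) ^ (-(2 : ℝ)) = ((p : ℝ) ^ 2)⁻¹ := by
    rw [Real.rpow_neg hp0.le, Real.rpow_two]
  have hden : (1 : ℝ) - ((p : ℝ) ^ 2)⁻¹ ≠ 0 := by
    have : ((p : ℝ) ^ 2)⁻¹ < 1 := inv_lt_one_of_one_lt₀ (by nlinarith)
    linarith
  have hcont : ContinuousAt Φ 2 := by
    simp only [hΦ]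
    refine (continuousAt_const.sub hx).inv₀ ?_
    show (1 : ℝ) - (p : ℝ) ^ (-(2 : ℝ)) ≠ 0
    rw [hx2]
    exact hden
  have hR := rankinResidue_eq_mul_of_twist hp2 C hW' hW'0 D D' hcont hΦw
  have hp21 : (p : ℝ) ^ 2 - 1 ≠ 0 := by nlinarith
  have hΦ2 : Φ 2 * ((p : ℝ) ^ 2 - 1) = (p : ℝ) ^ 2 := by
    simp only [hΦ]
    rw [hx2]
    field_simp [hp21]
  have hM0 : M ≠ 0 := NeZero.ne M
  have hψ : (gamma0Index N : ℝ) = p * gamma0Index M := by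
    rw [hN, gamma0Index_mul_of_prime_dvd hp hM0 hM]
    push_cast
    ring
  have hψM : (gamma0Index M : ℝ) ≠ 0 := by exact_mod_cast (gamma0Index_pos M).ne'
  have hπ : (π : ℝ) ≠ 0 := Real.pi_ne_zero
  set P := (peterssonProduct (Gamma0 M) 2 D.f D.f).re with hP
  set P' := (peterssonProduct (Gamma0 N) 2 D'.f D'.f).re with hP'
  have hR' : P * (p : ℝ) = Φ 2 * P' := by
    rw [hψ] at hR
    field_simp at hR
    linear_combination hR
  have h3 : (P * ((p : ℝ) ^ 2 - 1) - p * P') * (p : ℝ) = 0 := by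
    linear_combination ((p : ℝ) ^ 2 - 1) * hR' + P' * hΦ2
  have hPV : P * ((p : ℝ) ^ 2 - 1) = p * P' := by
    have := (mul_eq_zero.mp h3).resolve_right hp0.ne'
    linarith
  exact deg_mul_sq_mul_sq_eq_of_peterssonProduct_mul_eq C hW' D D' hPV

/-- **Good prime, Manin constants on models with `|u| = 1`** (e.g. `W` globally minimal with good
reduction at `p` and `W'` a globally minimal model of `W ⊗ χ_{p*}`: no re-minimalisation occurs at
`p`, where `v_p(Δ') = 6`, nor away from `p`, where `p*` is a unit): the identity in `ℤ`,
`D'.deg · D.c² = (p − 1)((p + 1)² − a_p²) · D.deg · D'.c²`. [cite: Watkins2002, §2.1 (p. 491)] -/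
theorem deg_mul_sq_eq_of_quadraticTwist_pStar_of_hasGoodReductionAtPrime_of_abs_u_eq_one (hp2 : p ≠ 2)
    (hgood : W.HasGoodReductionAtPrime p) (C : WeierstrassCurve.VariableChange ℚ)
    (hW' : C • W.quadraticTwist (((-1 : ℤ) ^ (p / 2) * p : ℤ) : ℚ) = W') (hu : |(C.u : ℚ)| = 1)
    (hW'0 : ∀ n : ℕ, p ∣ n → W'.LFunction n = 0)
    (D : ModularParametrizationData W M) (D' : ModularParametrizationData W' N)
    (hM : ¬ p ∣ M) (hN : N = p ^ 2 * M) :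
    (D'.deg : ℤ) * D.c ^ 2 = ((p : ℤ) - 1) * (((p : ℤ) + 1) ^ 2 - W.LFunction p ^ 2) * D.deg * D'.c ^ 2 := by
  have h := deg_mul_sq_mul_sq_eq_of_quadraticTwist_pStar_of_hasGoodReductionAtPrime hp2 hgood C hW'
    hW'0 D D' hM hN
  have hu2 : ((C.u : ℚ) : ℝ) ^ 2 = 1 := by
    rw [← sq_abs, ← Rat.cast_abs, hu, Rat.cast_one, one_pow]
  rw [hu2, mul_one] at h
  exact_mod_cast h

/-- **Multiplicative prime, Manin constants on models with `|u| = 1`**: the identity in `ℤ`,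
`D'.deg · D.c² = (p² − 1) · D.deg · D'.c²`. [cite: Watkins2002, §2.1 (p. 491)] -/
theorem deg_mul_sq_eq_of_quadraticTwist_pStar_of_hasMultiplicativeReductionAtPrime_of_abs_u_eq_one
    (hp2 : p ≠ 2) (hmult : W.HasMultiplicativeReductionAtPrime p) (C : WeierstrassCurve.VariableChange ℚ)
    (hW' : C • W.quadraticTwist (((-1 : ℤ) ^ (p / 2) * p : ℤ) : ℚ) = W') (hu : |(C.u : ℚ)| = 1)
    (hW'0 : ∀ n : ℕ, p ∣ n → W'.LFunction n = 0)
    (D : ModularParametrizationData W M) (D' : ModularParametrizationData W' N)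
    (hM : p ∣ M) (hN : N = p * M) :
    (D'.deg : ℤ) * D.c ^ 2 = ((p : ℤ) ^ 2 - 1) * D.deg * D'.c ^ 2 := by
  have h := deg_mul_sq_mul_sq_eq_of_quadraticTwist_pStar_of_hasMultiplicativeReductionAtPrime hp2 hmult
    C hW' hW'0 D D' hM hN
  have hu2 : ((C.u : ℚ) : ℝ) ^ 2 = 1 := by
    rw [← sq_abs, ← Rat.cast_abs, hu, Rat.cast_one, one_pow]
  rw [hu2, mul_one] at h
  exact_mod_cast h

end ModularParametrizationData

end Main
end Literature.NumberTheory.EllipticCurves.ModularForms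

end
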